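import Summits.NavierStokesRegularity.NavierStokesRegularity.Theorems.SqueezeCycleRecurrentLiouvilleDecayedReduction
import Summits.NavierStokesRegularity.NavierStokesRegularity.Theorems.SqueezeCycleRecurrentLiouvilleDarkApexProfiles
import HarnessLib

/-!
# Crux `RecurrentLiouville` (stmt-NavierStokesRegularity-1589), line `Sketch` — the residual
# stub S2 (`stub_satRadiatingLiouville`) is exactly apex-class Type-I Liouville

Theorems-only file (no definitions, no named facts); `--supports` helper for the registered stub
`stub_satRadiatingLiouville` (S2) of the skeleton `Cruxes/RecurrentLiouville/Lines/Sketch.lean`.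

S2 says: a suitable weak solution `(w, q)` of Navier–Stokes (`ν = 1`, `f = 0`) on the backward
slab `(-∞,0) × ℝ³` with weak gradient `H`, Albritton–Barker `𝐈 < ⊤`, the APEX bound
`‖w(t,x)‖ ≤ C'/(‖x‖ + √(−t))`, UNIFORMLY RECURRENT under the scaling flow and RADIATING (its
final-time trace does not vanish off any ball in `𝒟'`) is regular at the origin.  This file
identifies S2, sorry-free, with a hypothesis-free statement that already has a name in the tree:

* `satRR_apexLiouville_of_radiating` (B1): S2 ⟹ APEX-CLASS TYPE-I LIOUVILLE — every suitable
  weak solution on the slab with weak gradient, `𝐈 < ⊤` and the apex bound is regular at the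
  origin; no recurrence, no radiation hypothesis.  (By contradiction: the decayed recurrent
  reduction S3 `stub_satDecayedReduction` re-supplies recurrence inside the apex class with the
  same constant; a DARK recurrent apex profile is regular by `stub_satDarkApexProfiles`
  (Escauriaza–Seregin–Šverák), a RADIATING one by S2.)  The conclusion of B1 is, letter for
  letter, the target `X = NoApexTypeIProfile` of route RellichScar (item
  stmt-NavierStokesRegularity-11716, `Theses/RellichScar.lean`; not imported here to keep the
  Theses ⟂ Theorems import order acyclic) and the skeleton's `apexClassLiouville_of_stubs`.
* `satRR_radiating_of_apexLiouville` (B2): the converse (drop recurrence and radiation).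
  Hence S2 ⟺ apex-class Type-I Liouville ⟺ item 11716: the residue of line `Sketch` below the
  structural stub S1a is crux-sized and NAMED.
* `satRR_typeIDSSLiouvilleInClass_of_radiating` (B3): S2 ⟹ the a.e.-`λ`-DSS rung of the apex
  class INSIDE the crux's class, for every `λ > 1` and WITHOUT the wall `TypeIDSSLiouville λ`
  (Tsai's conjecture, Bradshaw–Tsai OP 5.1) that `stub_satClosingEndpoints`, clause (c), has to
  assume: on the class, S2 subsumes that hypothesis.  (The literal `TypeIDSSLiouville λ` — for
  ancient MILD `λ`-DSS fields with the apex bound and measurable slices — is not derived: the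
  tree has the class ⟹ mild direction (`exists_oseenMild_repr_of_typeIBound_lt_top`,
  `isTypeIAncientMild_of_continuous_oseenMild`) but no theorem producing, from a Type-I ancient
  mild field, a pressure making it suitable weak on the slab with `𝐈 < ⊤`.)
* `stub_satRadiatingResidualTools`: the registered tools sub-stub, B1 ∧ B2 ∧ B3.

## References

* D. Albritton, T. Barker, J. Math. Fluid Mech. 21 (2019) = arXiv:1811.00502, Thm. 1.1, §3.
  [AlbrittonBarker2019]
* L. Escauriaza, G. Seregin, V. Šverák, Russ. Math. Surveys 58 (2003) 211–250, §3, Thms. 4.1,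
  5.1. [EscauriazaSereginSverak2003]
* Z. Bradshaw, T.-P. Tsai, Comm. PDE 42 (2017) = arXiv:1610.05680, §5, Open Problem 5.1.
  [BradshawTsai2017CPDE]
* G. Koch, N. Nadirashvili, G. Seregin, V. Šverák, Acta Math. 203 (2009), (1.6). [KNSS2009]
-/

noncomputable section

-- the sub-problem namespace repeats the summit name (D-0017 layout `Summit.<S>.<P>.Theorems`)
set_option linter.dupNamespace false

namespace Summit.NavierStokesRegularity.NavierStokesRegularity.Theorems

open MeasureTheory Set Function Filter Topology TopologicalSpace Metric
open Literature.Analysis.FluidPDE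
open scoped NNReal ENNReal RealInnerProductSpace

/-! ## B1 — S2 implies apex-class Type-I Liouville -/

/-- **B1. The radiating stub S2 implies Type-I Liouville on the whole apex class** (no
recurrence, no radiation hypothesis): if S2 holds, every suitable weak solution `(u, p)`
(`ν = 1`, `f = 0`) on the backward slab with weak gradient `G`, `𝐈 < ⊤` and the apex bound
`‖u(t,x)‖ ≤ C/(‖x‖ + √(−t))` is regular at the origin.  By contradiction: the decayed recurrent
reduction (`stub_satDecayedReduction`: Birkhoff–Furstenberg on the `L³_loc` orbit closure,
Albritton–Barker compactness and persistence of singularities) turns a singular apex profile into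
a uniformly recurrent singular apex profile `w` with the same constant; if the final-time trace
of `w` vanishes off some ball, `w` is regular by `stub_satDarkApexProfiles`
(Escauriaza–Seregin–Šverák); otherwise `w` radiates and S2 makes it regular.  The conclusion is
verbatim item stmt-NavierStokesRegularity-11716 (`RellichScar.NoApexTypeIProfile`).
[cite: AlbrittonBarker2019, Thm 1.1 and §3] [cite: EscauriazaSereginSverak2003, §3 with Thms. 4.1 and 5.1] -/
theorem satRR_apexLiouville_of_radiating :
    (∀ (w : ℝ → EuclideanSpace ℝ (Fin 3) → EuclideanSpace ℝ (Fin 3))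
      (q : ℝ → EuclideanSpace ℝ (Fin 3) → ℝ)
      (H : ℝ → EuclideanSpace ℝ (Fin 3) → EuclideanSpace ℝ (Fin 3) →L[ℝ] EuclideanSpace ℝ (Fin 3)) (C' : ℝ),
      IsSuitableWeakSolutionOn (slab (EuclideanSpace ℝ (Fin 3)) (Iio 0) isOpen_Iio) 1 0 w q →
      HasWeakSpatialGradientOn (slab (EuclideanSpace ℝ (Fin 3)) (Iio 0) isOpen_Iio) w H →
      typeIBound (Iio (0 : ℝ) ×ˢ univ) w q H < ⊤ → HasTypeIDecay C' w →
      IsScalingUniformlyRecurrent w →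
      (¬ ∃ R : ℝ, ∀ φ : EuclideanSpace ℝ (Fin 3) → EuclideanSpace ℝ (Fin 3),
        Literature.Analysis.FunctionSpaces.IsTestFunctionOn (⊤ : Opens (EuclideanSpace ℝ (Fin 3))) φ →
        tsupport φ ⊆ (closedBall (0 : EuclideanSpace ℝ (Fin 3)) R)ᶜ →
        Tendsto (fun t => ∫ x, ⟪w t x, φ x⟫) (𝓝[<] (0 : ℝ)) (𝓝 0)) →
      ¬ IsBackwardSingularPoint w 0) →
    ∀ (u : ℝ → EuclideanSpace ℝ (Fin 3) → EuclideanSpace ℝ (Fin 3))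
      (p : ℝ → EuclideanSpace ℝ (Fin 3) → ℝ)
      (G : ℝ → EuclideanSpace ℝ (Fin 3) → EuclideanSpace ℝ (Fin 3) →L[ℝ] EuclideanSpace ℝ (Fin 3)) (C : ℝ),
      IsSuitableWeakSolutionOn (slab (EuclideanSpace ℝ (Fin 3)) (Iio 0) isOpen_Iio) 1 0 u p →
      HasWeakSpatialGradientOn (slab (EuclideanSpace ℝ (Fin 3)) (Iio 0) isOpen_Iio) u G →
      typeIBound (Iio (0 : ℝ) ×ˢ univ) u p G < ⊤ → HasTypeIDecay C u →
      ¬ IsBackwardSingularPoint u 0 := by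
  intro hS2 u p G C hsw hwg hI hdec hsing
  -- S3: recurrence is not load-bearing in the apex class (same constant `C`)
  obtain ⟨w, q, H, hsw', hwg', hI', hdec', hsing', hrec'⟩ :=
    stub_satDecayedReduction u p G C hsw hwg hI hdec hsing
  -- dark / radiating dichotomy on the final-time trace of `w` off a ball
  by_cases hdark : ∃ R : ℝ, ∀ φ : EuclideanSpace ℝ (Fin 3) → EuclideanSpace ℝ (Fin 3),
      Literature.Analysis.FunctionSpaces.IsTestFunctionOn (⊤ : Opens (EuclideanSpace ℝ (Fin 3))) φ →
      tsupport φ ⊆ (closedBall (0 : EuclideanSpace ℝ (Fin 3)) R)ᶜ →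
      Tendsto (fun t => ∫ x, ⟪w t x, φ x⟫) (𝓝[<] (0 : ℝ)) (𝓝 0)
  · exact stub_satDarkApexProfiles w q H C hsw' hwg' hI' hdec' hdark hsing'
  · exact hS2 w q H C hsw' hwg' hI' hdec' hrec' hdark hsing'

/-! ## B2 — the converse -/

/-- **B2. Apex-class Type-I Liouville implies the radiating stub S2** (drop recurrence and the
radiation hypothesis).  With B1: S2 ⟺ apex-class Type-I Liouville (item
stmt-NavierStokesRegularity-11716). [folklore] -/
theorem satRR_radiating_of_apexLiouville :
    (∀ (u : ℝ → EuclideanSpace ℝ (Fin 3) → EuclideanSpace ℝ (Fin 3))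
      (p : ℝ → EuclideanSpace ℝ (Fin 3) → ℝ)
      (G : ℝ → EuclideanSpace ℝ (Fin 3) → EuclideanSpace ℝ (Fin 3) →L[ℝ] EuclideanSpace ℝ (Fin 3)) (C : ℝ),
      IsSuitableWeakSolutionOn (slab (EuclideanSpace ℝ (Fin 3)) (Iio 0) isOpen_Iio) 1 0 u p →
      HasWeakSpatialGradientOn (slab (EuclideanSpace ℝ (Fin 3)) (Iio 0) isOpen_Iio) u G →
      typeIBound (Iio (0 : ℝ) ×ˢ univ) u p G < ⊤ → HasTypeIDecay C u →
      ¬ IsBackwardSingularPoint u 0) →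
    ∀ (w : ℝ → EuclideanSpace ℝ (Fin 3) → EuclideanSpace ℝ (Fin 3))
      (q : ℝ → EuclideanSpace ℝ (Fin 3) → ℝ)
      (H : ℝ → EuclideanSpace ℝ (Fin 3) → EuclideanSpace ℝ (Fin 3) →L[ℝ] EuclideanSpace ℝ (Fin 3)) (C' : ℝ),
      IsSuitableWeakSolutionOn (slab (EuclideanSpace ℝ (Fin 3)) (Iio 0) isOpen_Iio) 1 0 w q →
      HasWeakSpatialGradientOn (slab (EuclideanSpace ℝ (Fin 3)) (Iio 0) isOpen_Iio) w H →
      typeIBound (Iio (0 : ℝ) ×ˢ univ) w q H < ⊤ → HasTypeIDecay C' w →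
      IsScalingUniformlyRecurrent w →
      (¬ ∃ R : ℝ, ∀ φ : EuclideanSpace ℝ (Fin 3) → EuclideanSpace ℝ (Fin 3),
        Literature.Analysis.FunctionSpaces.IsTestFunctionOn (⊤ : Opens (EuclideanSpace ℝ (Fin 3))) φ →
        tsupport φ ⊆ (closedBall (0 : EuclideanSpace ℝ (Fin 3)) R)ᶜ →
        Tendsto (fun t => ∫ x, ⟪w t x, φ x⟫) (𝓝[<] (0 : ℝ)) (𝓝 0)) →
      ¬ IsBackwardSingularPoint w 0 :=
  fun hAL w q H C' hsw hwg hI hdec _ _ => hAL w q H C' hsw hwg hI hdec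

/-! ## B3 — the `λ`-DSS rung inside the class, without the wall -/

/-- **B3. S2 implies the a.e.-`λ`-DSS rung of the apex class inside the crux's class, for every
`λ > 1`, unconditionally**: an a.e. `λ`-self-similar (`λ u(λ²t, λx) = u(t, x)` a.e. on the slab)
suitable weak solution on the slab with weak gradient, `𝐈 < ⊤` and the apex bound is regular at
the origin.  This is clause (c) of `stub_satClosingEndpoints` with its hypothesis
`TypeIDSSLiouville λ` (Tsai's conjecture; Bradshaw–Tsai, §5 Open Problem 5.1) REMOVED: on the
class, S2 subsumes the wall (immediate from B1, which does not even use self-similarity).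
[cite: BradshawTsai2017CPDE, §5 Open Problem 5.1] -/
theorem satRR_typeIDSSLiouvilleInClass_of_radiating :
    (∀ (w : ℝ → EuclideanSpace ℝ (Fin 3) → EuclideanSpace ℝ (Fin 3))
      (q : ℝ → EuclideanSpace ℝ (Fin 3) → ℝ)
      (H : ℝ → EuclideanSpace ℝ (Fin 3) → EuclideanSpace ℝ (Fin 3) →L[ℝ] EuclideanSpace ℝ (Fin 3)) (C' : ℝ),
      IsSuitableWeakSolutionOn (slab (EuclideanSpace ℝ (Fin 3)) (Iio 0) isOpen_Iio) 1 0 w q →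
      HasWeakSpatialGradientOn (slab (EuclideanSpace ℝ (Fin 3)) (Iio 0) isOpen_Iio) w H →
      typeIBound (Iio (0 : ℝ) ×ˢ univ) w q H < ⊤ → HasTypeIDecay C' w →
      IsScalingUniformlyRecurrent w →
      (¬ ∃ R : ℝ, ∀ φ : EuclideanSpace ℝ (Fin 3) → EuclideanSpace ℝ (Fin 3),
        Literature.Analysis.FunctionSpaces.IsTestFunctionOn (⊤ : Opens (EuclideanSpace ℝ (Fin 3))) φ →
        tsupport φ ⊆ (closedBall (0 : EuclideanSpace ℝ (Fin 3)) R)ᶜ →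
        Tendsto (fun t => ∫ x, ⟪w t x, φ x⟫) (𝓝[<] (0 : ℝ)) (𝓝 0)) →
      ¬ IsBackwardSingularPoint w 0) →
    ∀ (u : ℝ → EuclideanSpace ℝ (Fin 3) → EuclideanSpace ℝ (Fin 3))
      (p : ℝ → EuclideanSpace ℝ (Fin 3) → ℝ)
      (G : ℝ → EuclideanSpace ℝ (Fin 3) → EuclideanSpace ℝ (Fin 3) →L[ℝ] EuclideanSpace ℝ (Fin 3))
      (C lam : ℝ),
      IsSuitableWeakSolutionOn (slab (EuclideanSpace ℝ (Fin 3)) (Iio 0) isOpen_Iio) 1 0 u p →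
      HasWeakSpatialGradientOn (slab (EuclideanSpace ℝ (Fin 3)) (Iio 0) isOpen_Iio) u G →
      typeIBound (Iio (0 : ℝ) ×ˢ univ) u p G < ⊤ → HasTypeIDecay C u → 1 < lam →
      (∀ᵐ z ∂(volume.restrict (Iio (0 : ℝ) ×ˢ (univ : Set (EuclideanSpace ℝ (Fin 3))))),
        nsRescale lam u z.1 z.2 = u z.1 z.2) →
      ¬ IsBackwardSingularPoint u 0 :=
  fun hS2 u p G C _ hsw hwg hI hdec _ _ => satRR_apexLiouville_of_radiating hS2 u p G C hsw hwg hI hdec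

/-! ## The registered tools sub-stub -/

/-- **Tools sub-stub of S2 (`stub_satRadiatingLiouville`)**: the conjunction B1 ∧ B2 ∧ B3 —
S2 ⟹ apex-class Type-I Liouville (item stmt-NavierStokesRegularity-11716 verbatim), its
converse, and S2 ⟹ the in-class a.e.-`λ`-DSS rung for every `λ > 1` without Tsai's wall.
Registered stub (`stub_satRadiatingResidualTools`) of crux stmt-NavierStokesRegularity-1589.
[cite: AlbrittonBarker2019, Thm 1.1 and §3] [cite: BradshawTsai2017CPDE, §5 Open Problem 5.1] -/
theorem stub_satRadiatingResidualTools :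
    ((∀ (w : ℝ → EuclideanSpace ℝ (Fin 3) → EuclideanSpace ℝ (Fin 3))
      (q : ℝ → EuclideanSpace ℝ (Fin 3) → ℝ)
      (H : ℝ → EuclideanSpace ℝ (Fin 3) → EuclideanSpace ℝ (Fin 3) →L[ℝ] EuclideanSpace ℝ (Fin 3)) (C' : ℝ),
      IsSuitableWeakSolutionOn (slab (EuclideanSpace ℝ (Fin 3)) (Iio 0) isOpen_Iio) 1 0 w q →
      HasWeakSpatialGradientOn (slab (EuclideanSpace ℝ (Fin 3)) (Iio 0) isOpen_Iio) w H →
      typeIBound (Iio (0 : ℝ) ×ˢ univ) w q H < ⊤ → HasTypeIDecay C' w →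
      IsScalingUniformlyRecurrent w →
      (¬ ∃ R : ℝ, ∀ φ : EuclideanSpace ℝ (Fin 3) → EuclideanSpace ℝ (Fin 3),
        Literature.Analysis.FunctionSpaces.IsTestFunctionOn (⊤ : Opens (EuclideanSpace ℝ (Fin 3))) φ →
        tsupport φ ⊆ (closedBall (0 : EuclideanSpace ℝ (Fin 3)) R)ᶜ →
        Tendsto (fun t => ∫ x, ⟪w t x, φ x⟫) (𝓝[<] (0 : ℝ)) (𝓝 0)) →
      ¬ IsBackwardSingularPoint w 0) →
    ∀ (u : ℝ → EuclideanSpace ℝ (Fin 3) → EuclideanSpace ℝ (Fin 3))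
      (p : ℝ → EuclideanSpace ℝ (Fin 3) → ℝ)
      (G : ℝ → EuclideanSpace ℝ (Fin 3) → EuclideanSpace ℝ (Fin 3) →L[ℝ] EuclideanSpace ℝ (Fin 3)) (C : ℝ),
      IsSuitableWeakSolutionOn (slab (EuclideanSpace ℝ (Fin 3)) (Iio 0) isOpen_Iio) 1 0 u p →
      HasWeakSpatialGradientOn (slab (EuclideanSpace ℝ (Fin 3)) (Iio 0) isOpen_Iio) u G →
      typeIBound (Iio (0 : ℝ) ×ˢ univ) u p G < ⊤ → HasTypeIDecay C u →
      ¬ IsBackwardSingularPoint u 0) ∧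
    ((∀ (u : ℝ → EuclideanSpace ℝ (Fin 3) → EuclideanSpace ℝ (Fin 3))
      (p : ℝ → EuclideanSpace ℝ (Fin 3) → ℝ)
      (G : ℝ → EuclideanSpace ℝ (Fin 3) → EuclideanSpace ℝ (Fin 3) →L[ℝ] EuclideanSpace ℝ (Fin 3)) (C : ℝ),
      IsSuitableWeakSolutionOn (slab (EuclideanSpace ℝ (Fin 3)) (Iio 0) isOpen_Iio) 1 0 u p →
      HasWeakSpatialGradientOn (slab (EuclideanSpace ℝ (Fin 3)) (Iio 0) isOpen_Iio) u G →
      typeIBound (Iio (0 : ℝ) ×ˢ univ) u p G < ⊤ → HasTypeIDecay C u →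
      ¬ IsBackwardSingularPoint u 0) →
    ∀ (w : ℝ → EuclideanSpace ℝ (Fin 3) → EuclideanSpace ℝ (Fin 3))
      (q : ℝ → EuclideanSpace ℝ (Fin 3) → ℝ)
      (H : ℝ → EuclideanSpace ℝ (Fin 3) → EuclideanSpace ℝ (Fin 3) →L[ℝ] EuclideanSpace ℝ (Fin 3)) (C' : ℝ),
      IsSuitableWeakSolutionOn (slab (EuclideanSpace ℝ (Fin 3)) (Iio 0) isOpen_Iio) 1 0 w q →
      HasWeakSpatialGradientOn (slab (EuclideanSpace ℝ (Fin 3)) (Iio 0) isOpen_Iio) w H →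
      typeIBound (Iio (0 : ℝ) ×ˢ univ) w q H < ⊤ → HasTypeIDecay C' w →
      IsScalingUniformlyRecurrent w →
      (¬ ∃ R : ℝ, ∀ φ : EuclideanSpace ℝ (Fin 3) → EuclideanSpace ℝ (Fin 3),
        Literature.Analysis.FunctionSpaces.IsTestFunctionOn (⊤ : Opens (EuclideanSpace ℝ (Fin 3))) φ →
        tsupport φ ⊆ (closedBall (0 : EuclideanSpace ℝ (Fin 3)) R)ᶜ →
        Tendsto (fun t => ∫ x, ⟪w t x, φ x⟫) (𝓝[<] (0 : ℝ)) (𝓝 0)) →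
      ¬ IsBackwardSingularPoint w 0) ∧
    ((∀ (w : ℝ → EuclideanSpace ℝ (Fin 3) → EuclideanSpace ℝ (Fin 3))
      (q : ℝ → EuclideanSpace ℝ (Fin 3) → ℝ)
      (H : ℝ → EuclideanSpace ℝ (Fin 3) → EuclideanSpace ℝ (Fin 3) →L[ℝ] EuclideanSpace ℝ (Fin 3)) (C' : ℝ),
      IsSuitableWeakSolutionOn (slab (EuclideanSpace ℝ (Fin 3)) (Iio 0) isOpen_Iio) 1 0 w q →
      HasWeakSpatialGradientOn (slab (EuclideanSpace ℝ (Fin 3)) (Iio 0) isOpen_Iio) w H →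
      typeIBound (Iio (0 : ℝ) ×ˢ univ) w q H < ⊤ → HasTypeIDecay C' w →
      IsScalingUniformlyRecurrent w →
      (¬ ∃ R : ℝ, ∀ φ : EuclideanSpace ℝ (Fin 3) → EuclideanSpace ℝ (Fin 3),
        Literature.Analysis.FunctionSpaces.IsTestFunctionOn (⊤ : Opens (EuclideanSpace ℝ (Fin 3))) φ →
        tsupport φ ⊆ (closedBall (0 : EuclideanSpace ℝ (Fin 3)) R)ᶜ →
        Tendsto (fun t => ∫ x, ⟪w t x, φ x⟫) (𝓝[<] (0 : ℝ)) (𝓝 0)) →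
      ¬ IsBackwardSingularPoint w 0) →
    ∀ (u : ℝ → EuclideanSpace ℝ (Fin 3) → EuclideanSpace ℝ (Fin 3))
      (p : ℝ → EuclideanSpace ℝ (Fin 3) → ℝ)
      (G : ℝ → EuclideanSpace ℝ (Fin 3) → EuclideanSpace ℝ (Fin 3) →L[ℝ] EuclideanSpace ℝ (Fin 3))
      (C lam : ℝ),
      IsSuitableWeakSolutionOn (slab (EuclideanSpace ℝ (Fin 3)) (Iio 0) isOpen_Iio) 1 0 u p →
      HasWeakSpatialGradientOn (slab (EuclideanSpace ℝ (Fin 3)) (Iio 0) isOpen_Iio) u G →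
      typeIBound (Iio (0 : ℝ) ×ˢ univ) u p G < ⊤ → HasTypeIDecay C u → 1 < lam →
      (∀ᵐ z ∂(volume.restrict (Iio (0 : ℝ) ×ˢ (univ : Set (EuclideanSpace ℝ (Fin 3))))),
        nsRescale lam u z.1 z.2 = u z.1 z.2) →
      ¬ IsBackwardSingularPoint u 0) :=
  ⟨satRR_apexLiouville_of_radiating, satRR_radiating_of_apexLiouville,
    satRR_typeIDSSLiouvilleInClass_of_radiating⟩

end Summit.NavierStokesRegularity.NavierStokesRegularity.Theorems

end
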